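import Literature.AlgebraicGeometry.Modules.BoxTensor
import HarnessLib

/-!
# Pull-back commutes with the tensor product of `𝒪`-modules (The Stacks Project, Tag 01CD) — NAMED FACT

Layer `Literature/AlgebraicGeometry/Modules`; namespace `Literature.AlgebraicGeometry.Modules`. ONE NAMED FACT (D-0014) and its
unfoldings; no instance, no notation; nothing is proved here beyond projections of the fact.

Source, verbatim (The Stacks Project, Chapter *Sheaves of Modules*, §17.16 Tensor product): "Lemma 17.16.4 (Tag 01CD). Let
`f : (X, 𝒪_X) → (Y, 𝒪_Y)` be a morphism of ringed spaces. Let `𝓕`, `𝓖` be `𝒪_Y`-modules. Then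
`f^*(𝓕 ⊗_{𝒪_Y} 𝓖) = f^*𝓕 ⊗_{𝒪_X} f^*𝓖` functorially in `𝓕`, `𝓖`. Proof. Omitted."

In the tree's vocabulary: the tensor product is `Modules.tensorObj` (the sheafification of the presheaf tensor product, Stacks 01CA,
`Modules/TensorProduct`), packaged as the bifunctor `Modules.tensorBifunctor X : X.Modules ⥤ X.Modules ⥤ X.Modules` (`Modules/BoxTensor`,
`(tensorBifunctor X).obj N = N ⊗ –`); the pull-back is Mathlib's `Scheme.Modules.pullback f` (left adjoint to `f_*`). The fact is stated
for morphisms of SCHEMES and as a natural isomorphism in the SECOND variable, `(N ⊗ –) ⋙ f^* ≅ f^* ⋙ (f^*N ⊗ –)` — the form the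
consumers need (twisting cochain complexes termwise by a fixed module `N` commutes with `f^*` up to isomorphism of complexes).

WHY A FACT AND NOT A THEOREM (yet): `Modules/TensorProduct` constructs `⊗` by sheafifying Mathlib's presheaf tensor product and
deliberately provides neither its compatibility with pull-back nor the associator ∕ symmetry; Mathlib's `SheafOfModules.pullback` is
defined abstractly as a left adjoint, so the comparison needs either the tensor–hom adjunction for `𝒪`-modules or the compatibility
of sheafification with the presheaf tensor product — neither is in the tree at this pin (line card `Lines/NowhereDisplaceable.md`
rev 6.1 § (M3b) of the Hodge road №4 records the gap). Consumer: road №4 of the Hodge atlas, crux stmt-HodgeConjecture-26512, route «2T»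
step (i) (`Theorems/VHCAbelianSchemesRoadExtJumpLocusLinearisedTwist`, hypothesis `c` at `f = τ_x`); library only — proves nothing about
(N-U), 26512, №4, HC_AV or HC.

-- TODO(general form): ringed spaces; naturality in BOTH variables (a monoidal structure on `f^*`), and the companion
-- compatibilities with the associator, unitors and symmetry once `Modules/TensorProduct` has them.

## References

* The Stacks Project, Tag 01CD (Modules, Lemma 17.16.4); Tag 01CA (tensor product of `𝒪_X`-modules). [StacksProject]
* R. Hartshorne, *Algebraic Geometry* (1977), II §5 p. 110 (`f^*`, `⊗`). [Hartshorne1977]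
-/

noncomputable section

open CategoryTheory AlgebraicGeometry

universe u

namespace Literature.AlgebraicGeometry.Modules

/-- **The Stacks Project, Tag 01CD (Modules, Lemma 17.16.4) — pull-back commutes with the tensor product**: "Let
`f : (X, 𝒪_X) → (Y, 𝒪_Y)` be a morphism of ringed spaces. Let `𝓕`, `𝓖` be `𝒪_Y`-modules. Then `f^*(𝓕 ⊗_{𝒪_Y} 𝓖) = f^*𝓕 ⊗_{𝒪_X} f^*𝓖`
functorially in `𝓕`, `𝓖`." Here for a morphism of schemes `f : X ⟶ Y` and a fixed `𝒪_Y`-module `N`, as a natural isomorphism of functors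
`Mod(𝒪_Y) ⥤ Mod(𝒪_X)` in the second variable: `(N ⊗ –) ⋙ f^* ≅ f^* ⋙ (f^*N ⊗ –)` (the tree's `Modules.tensorBifunctor`, Mathlib's
`Scheme.Modules.pullback`). A NAMED FACT, not proved here; users take `(h : PullbackTensorObjIso)`.
[cite: StacksProject, Tag 01CD (Modules, Lemma 17.16.4)] -/
def PullbackTensorObjIso : Prop :=
  ∀ ⦃X Y : Scheme.{u}⦄ (f : X ⟶ Y) (N : Y.Modules),
    Nonempty ((tensorBifunctor Y).obj N ⋙ Scheme.Modules.pullback f ≅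
      Scheme.Modules.pullback f ⋙ (tensorBifunctor X).obj ((Scheme.Modules.pullback f).obj N))

namespace PullbackTensorObjIso

variable {X Y : Scheme.{u}}

/-- A chosen natural isomorphism `(N ⊗ –) ⋙ f^* ≅ f^* ⋙ (f^*N ⊗ –)` under the fact. [cite: StacksProject, Tag 01CD (Modules, Lemma 17.16.4)] -/
def natIso (h : PullbackTensorObjIso.{u}) (f : X ⟶ Y) (N : Y.Modules) :
    (tensorBifunctor Y).obj N ⋙ Scheme.Modules.pullback f ≅
      Scheme.Modules.pullback f ⋙ (tensorBifunctor X).obj ((Scheme.Modules.pullback f).obj N) :=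
  (h f N).some

/-- Objectwise: `f^*(N ⊗ M) ≅ f^*N ⊗ f^*M` under the fact. [cite: StacksProject, Tag 01CD (Modules, Lemma 17.16.4)] -/
def app (h : PullbackTensorObjIso.{u}) (f : X ⟶ Y) (N M : Y.Modules) :
    (Scheme.Modules.pullback f).obj (tensorObj N M) ≅ tensorObj ((Scheme.Modules.pullback f).obj N) ((Scheme.Modules.pullback f).obj M) :=
  (natIso h f N).app M

/-- Naturality in the second variable: `f^*(𝟙_N ⊗ g) ≫ app_{M'} = app_M ≫ (𝟙_{f^*N} ⊗ f^*g)`. [cite: StacksProject, Tag 01CD (Modules, Lemma 17.16.4)] -/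
theorem app_naturality (h : PullbackTensorObjIso.{u}) (f : X ⟶ Y) (N : Y.Modules) {M M' : Y.Modules} (g : M ⟶ M') :
    (Scheme.Modules.pullback f).map (tensorMap (𝟙 N) g) ≫ (app h f N M').hom =
      (app h f N M).hom ≫ tensorMap (𝟙 ((Scheme.Modules.pullback f).obj N)) ((Scheme.Modules.pullback f).map g) :=
  (natIso h f N).hom.naturality g

/-- `Nonempty` form of the objectwise isomorphism. [cite: StacksProject, Tag 01CD (Modules, Lemma 17.16.4)] -/
theorem nonempty_iso (h : PullbackTensorObjIso.{u}) (f : X ⟶ Y) (N M : Y.Modules) :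
    Nonempty ((Scheme.Modules.pullback f).obj (tensorObj N M) ≅
      tensorObj ((Scheme.Modules.pullback f).obj N) ((Scheme.Modules.pullback f).obj M)) :=
  ⟨app h f N M⟩

end PullbackTensorObjIso

end Literature.AlgebraicGeometry.Modules

end
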